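import Summits.CriticalPhenomena.PercolationContinuityZ3.Theorems.PercNearOneGluingNoHeavyLowerTailSahiMixtureLaw
import Literature.Combinatorics.Sahi2008.FKG
import Mathlib.Tactic.Linarith
import Mathlib.Tactic.Ring
import HarnessLib

/-!
# `NoHeavyLowerTail` (crux stmt-CriticalPhenomena-4575), master-family line P2: the ONE-COORDINATE DROP of `E_3` in INFLUENCE FORM,
# for real-valued functions and an arbitrary weight on the remaining coordinates; a coordinate seen conjunctively by two members never hurts

Support file (seat `prim-masterthm-p2`, gen 10; `--supports stmt-CriticalPhenomena-4575`); no definition, no sorry.  Memo SAHI-ROUTE.md §4.32.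

Setting: a finite type `α` with ANY weight `μ` (the "other coordinates"; no lattice or normalisation needed for the identity) and one independent
coin of bias `p`, i.e. the weight `SahiMixture.coinWeight μ p` on `α × Bool`; three functions `f g h : α × Bool → ℝ` with sections `f(·,false), f(·,true)`.
Write `I(f) := E_μ f(·,1) − E_μ f(·,0)` (the INFLUENCE of the coin on `f`), `I(gh) := E_μ[g₁h₁] − E_μ[g₀h₀]`, `Ē f := (1−p)E_μ f₀ + p E_μ f₁`.

* `sahiE_three_coinWeight` — **THE ONE-STEP IDENTITY (influence form)**:
    `E_3(μ⊗coin_p; f,g,h) = (1−p)·E_3(μ; f₀,g₀,h₀) + p·E_3(μ; f₁,g₁,h₁) + p(1−p)·R`,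
    `R = Σ_cyc I(f)·I(gh) − Σ_cyc Ē f·I(g)I(h) − ((1−p) − p)·I(f)I(g)I(h)`.
  (`R = (1−p)b₁ + p b₂` in the Bernstein pieces of `SahiCoordinateBernstein.sahiE_three_decomp_coord`, which is the indicator / product-measure case;
  here the other coordinates carry an arbitrary weight and the functions are real-valued.)  In the three-copy picture `p(1−p)R = E_3 − E_3^{(coin coupled)}`.
* `sahiE_three_ge_sections` — if `0 ≤ p ≤ 1` and `R ≥ 0` then `E_3 ≥ (1−p)E_3(sections at 0) + p E_3(sections at 1)` (the local step of every
  induction on the number of coordinates; `SahiCoordinateBernstein.sahiE_three_nonneg_of_goodCoord` is the indicator case with the stronger `b₁, b₂ ≥ 0`).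
* `sahiE_three_ge_sections_of_conjunctive` — **A COIN SEEN CONJUNCTIVELY BY TWO MEMBERS NEVER HURTS**: if `μ` is an FKG probability weight on a finite
  distributive lattice, `f = φ(a)` does not see the coin, `φ ≥ 0` is monotone, and the coin-INCREMENTS `g(·,1) − g(·,0)`, `h(·,1) − h(·,0)` are `≥ 0` and
  monotone (e.g. `g = ξ·g'`, `h = ξ·h'` — AND-ing the coin — or `g = g₀ + ξ·δ` with `δ ≥ 0` increasing; NO monotonicity of `g, h` in `a` is needed), then
  `R = I(g)·Cov_μ(φ, h₁−h₀) + I(h)·Cov_μ(φ, g₁−g₀) + E_μφ·I(g)I(h) ≥ 0` (FKG twice), hence `E_3(μ⊗coin_p; f,g,h) ≥ (1−p)E_3(μ; φ,g₀,h₀) + pE_3(μ; φ,g₁,h₁)`;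
  with `sahiE_three_nonneg_of_conjunctive`: nonnegative sections give `E_3 ≥ 0`.
Why this file (memo §4.32): gen 10 showed that the hybrid certificate of THEOREM B (all role variants, instance level) provably misses the fully-shared
'twisted 2-CNF' triples (e.g. the three perfect matchings of `K₄`: `E_3 = 265/4096`, all three variant tests `= −7/4096` at `p = ½`), and that on those
triples ONE-COORDINATE CONDITIONING pays with room to spare; the signed part of `R` is `Σ_cyc I(B)·Cov(1_{A₁}, 1_{piv C})` (sections against pivotal sets).
This file puts the exact influence form of the drop in the tree, for real-valued members and any weight on the other coordinates, with its first signed case.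
-/

noncomputable section

open scoped Classical

namespace Summit.CriticalPhenomena.PercolationContinuityZ3.Theorems

namespace SahiCoordinateInfluence

open Finset Function
open Literature.Combinatorics.Sahi2008
open SahiMixture (coinWeight ex_coinWeight)

variable {α : Type*} [Fintype α]

/-- **ONE-STEP IDENTITY in influence form**: `E_3` under `μ ⊗ coin_p` equals the `p`-mixture of the sectional `E_3`'s plus `p(1−p)` times
`Σ_cyc I(f)I(gh) − Σ_cyc Ēf·I(g)I(h) − ((1−p)−p)·I(f)I(g)I(h)` — for ANY weight `μ` on the other coordinates and real-valued `f, g, h`. [this work] -/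
theorem sahiE_three_coinWeight (μ : α → ℝ) (p : ℝ) (f g h : α × Bool → ℝ) :
    sahiE (coinWeight μ p) 3 ![f, g, h] =
      (1 - p) * sahiE μ 3 ![fun a => f (a, false), fun a => g (a, false), fun a => h (a, false)]
      + p * sahiE μ 3 ![fun a => f (a, true), fun a => g (a, true), fun a => h (a, true)]
      + p * (1 - p) *
        ( ( (ex μ (fun a => f (a, true)) - ex μ (fun a => f (a, false)))
              * (ex μ (fun a => g (a, true) * h (a, true)) - ex μ (fun a => g (a, false) * h (a, false)))
            + (ex μ (fun a => g (a, true)) - ex μ (fun a => g (a, false)))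
              * (ex μ (fun a => f (a, true) * h (a, true)) - ex μ (fun a => f (a, false) * h (a, false)))
            + (ex μ (fun a => h (a, true)) - ex μ (fun a => h (a, false)))
              * (ex μ (fun a => f (a, true) * g (a, true)) - ex μ (fun a => f (a, false) * g (a, false))) )
          - ( ((1 - p) * ex μ (fun a => f (a, false)) + p * ex μ (fun a => f (a, true)))
              * (ex μ (fun a => g (a, true)) - ex μ (fun a => g (a, false))) * (ex μ (fun a => h (a, true)) - ex μ (fun a => h (a, false)))
            + ((1 - p) * ex μ (fun a => g (a, false)) + p * ex μ (fun a => g (a, true)))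
              * (ex μ (fun a => f (a, true)) - ex μ (fun a => f (a, false))) * (ex μ (fun a => h (a, true)) - ex μ (fun a => h (a, false)))
            + ((1 - p) * ex μ (fun a => h (a, false)) + p * ex μ (fun a => h (a, true)))
              * (ex μ (fun a => f (a, true)) - ex μ (fun a => f (a, false))) * (ex μ (fun a => g (a, true)) - ex μ (fun a => g (a, false))) )
          - ((1 - p) - p) * (ex μ (fun a => f (a, true)) - ex μ (fun a => f (a, false)))
              * (ex μ (fun a => g (a, true)) - ex μ (fun a => g (a, false))) * (ex μ (fun a => h (a, true)) - ex μ (fun a => h (a, false))) ) := by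
  simp only [sahiE_three]
  simp only [ex_coinWeight]
  simp only [ex_def, Pi.mul_apply]
  ring

/-- **The local step**: if `0 ≤ p ≤ 1` and the influence remainder `R` is nonnegative, then `E_3` is at least the `p`-mixture of the two sectional
`E_3`'s. [this work] -/
theorem sahiE_three_ge_sections (μ : α → ℝ) {p : ℝ} (hp0 : 0 ≤ p) (hp1 : p ≤ 1) (f g h : α × Bool → ℝ)
    (hR : 0 ≤
        ( (ex μ (fun a => f (a, true)) - ex μ (fun a => f (a, false)))
              * (ex μ (fun a => g (a, true) * h (a, true)) - ex μ (fun a => g (a, false) * h (a, false)))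
            + (ex μ (fun a => g (a, true)) - ex μ (fun a => g (a, false)))
              * (ex μ (fun a => f (a, true) * h (a, true)) - ex μ (fun a => f (a, false) * h (a, false)))
            + (ex μ (fun a => h (a, true)) - ex μ (fun a => h (a, false)))
              * (ex μ (fun a => f (a, true) * g (a, true)) - ex μ (fun a => f (a, false) * g (a, false))) )
          - ( ((1 - p) * ex μ (fun a => f (a, false)) + p * ex μ (fun a => f (a, true)))
              * (ex μ (fun a => g (a, true)) - ex μ (fun a => g (a, false))) * (ex μ (fun a => h (a, true)) - ex μ (fun a => h (a, false)))
            + ((1 - p) * ex μ (fun a => g (a, false)) + p * ex μ (fun a => g (a, true)))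
              * (ex μ (fun a => f (a, true)) - ex μ (fun a => f (a, false))) * (ex μ (fun a => h (a, true)) - ex μ (fun a => h (a, false)))
            + ((1 - p) * ex μ (fun a => h (a, false)) + p * ex μ (fun a => h (a, true)))
              * (ex μ (fun a => f (a, true)) - ex μ (fun a => f (a, false))) * (ex μ (fun a => g (a, true)) - ex μ (fun a => g (a, false))) )
          - ((1 - p) - p) * (ex μ (fun a => f (a, true)) - ex μ (fun a => f (a, false)))
              * (ex μ (fun a => g (a, true)) - ex μ (fun a => g (a, false))) * (ex μ (fun a => h (a, true)) - ex μ (fun a => h (a, false)))) :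
    (1 - p) * sahiE μ 3 ![fun a => f (a, false), fun a => g (a, false), fun a => h (a, false)]
      + p * sahiE μ 3 ![fun a => f (a, true), fun a => g (a, true), fun a => h (a, true)]
      ≤ sahiE (coinWeight μ p) 3 ![f, g, h] := by
  rw [sahiE_three_coinWeight]
  have hpq : 0 ≤ p * (1 - p) := mul_nonneg hp0 (by linarith)
  nlinarith [mul_nonneg hpq hR]

/-- Linearity helper: `E[φ·u] − E[φ·v] = E[φ·(u − v)]`. [folklore] -/
theorem ex_mul_sub (μ φ u v : α → ℝ) :
    ex μ (fun a => φ a * u a) - ex μ (fun a => φ a * v a) = ex μ (fun a => φ a * (u a - v a)) := by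
  simp only [ex_def, ← Finset.sum_sub_distrib]
  exact Finset.sum_congr rfl fun a _ => by ring

/-- Linearity helper: `E[u] − E[v] = E[u − v]`. [folklore] -/
theorem ex_sub (μ u v : α → ℝ) : ex μ u - ex μ v = ex μ (fun a => u a - v a) := by
  simp only [ex_def, ← Finset.sum_sub_distrib]
  exact Finset.sum_congr rfl fun a _ => by ring

/-- **The influence remainder of a coin missed by `f` and seen CONJUNCTIVELY by `g` and `h` is nonnegative**: on an FKG poset, with `f = φ(a)`
(`φ ≥ 0` monotone) and coin-increments `g(·,1) − g(·,0)`, `h(·,1) − h(·,0)` nonnegative and monotone,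
`R = I(g)·Cov(φ, h₁−h₀) + I(h)·Cov(φ, g₁−g₀) + Eφ·I(g)I(h) ≥ 0`. [this work] -/
theorem remainder_nonneg_of_conjunctive [DistribLattice α] {μ : α → ℝ} (hμ : IsFKGMeasure μ) (p : ℝ)
    (φ : α → ℝ) (hφ0 : ∀ a, 0 ≤ φ a) (hφm : Monotone φ) (g h : α × Bool → ℝ)
    (hg0 : ∀ a, 0 ≤ g (a, true) - g (a, false)) (hgm : Monotone (fun a => g (a, true) - g (a, false)))
    (hh0 : ∀ a, 0 ≤ h (a, true) - h (a, false)) (hhm : Monotone (fun a => h (a, true) - h (a, false))) :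
    0 ≤ ( (ex μ (fun a => φ a) - ex μ (fun a => φ a))
              * (ex μ (fun a => g (a, true) * h (a, true)) - ex μ (fun a => g (a, false) * h (a, false)))
            + (ex μ (fun a => g (a, true)) - ex μ (fun a => g (a, false)))
              * (ex μ (fun a => φ a * h (a, true)) - ex μ (fun a => φ a * h (a, false)))
            + (ex μ (fun a => h (a, true)) - ex μ (fun a => h (a, false)))
              * (ex μ (fun a => φ a * g (a, true)) - ex μ (fun a => φ a * g (a, false))) )
          - ( ((1 - p) * ex μ (fun a => φ a) + p * ex μ (fun a => φ a))
              * (ex μ (fun a => g (a, true)) - ex μ (fun a => g (a, false))) * (ex μ (fun a => h (a, true)) - ex μ (fun a => h (a, false)))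
            + ((1 - p) * ex μ (fun a => g (a, false)) + p * ex μ (fun a => g (a, true)))
              * (ex μ (fun a => φ a) - ex μ (fun a => φ a)) * (ex μ (fun a => h (a, true)) - ex μ (fun a => h (a, false)))
            + ((1 - p) * ex μ (fun a => h (a, false)) + p * ex μ (fun a => h (a, true)))
              * (ex μ (fun a => φ a) - ex μ (fun a => φ a)) * (ex μ (fun a => g (a, true)) - ex μ (fun a => g (a, false))) )
          - ((1 - p) - p) * (ex μ (fun a => φ a) - ex μ (fun a => φ a))
              * (ex μ (fun a => g (a, true)) - ex μ (fun a => g (a, false))) * (ex μ (fun a => h (a, true)) - ex μ (fun a => h (a, false))) := by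
  -- the four moments that matter
  have hA : 0 ≤ ex μ (fun a => φ a) := ex_nonneg hμ.nonneg hφ0
  have hIg : 0 ≤ ex μ (fun a => g (a, true)) - ex μ (fun a => g (a, false)) := by
    rw [ex_sub]; exact ex_nonneg hμ.nonneg hg0
  have hIh : 0 ≤ ex μ (fun a => h (a, true)) - ex μ (fun a => h (a, false)) := by
    rw [ex_sub]; exact ex_nonneg hμ.nonneg hh0
  -- FKG twice: Cov(φ, h₁ − h₀) ≥ 0 and Cov(φ, g₁ − g₀) ≥ 0
  have hFh : ex μ (fun a => φ a) * (ex μ (fun a => h (a, true)) - ex μ (fun a => h (a, false)))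
      ≤ ex μ (fun a => φ a * h (a, true)) - ex μ (fun a => φ a * h (a, false)) := by
    rw [ex_sub, ex_mul_sub]
    exact ex_mul_ex_le_ex_mul hμ hφ0 hh0 hφm hhm
  have hFg : ex μ (fun a => φ a) * (ex μ (fun a => g (a, true)) - ex μ (fun a => g (a, false)))
      ≤ ex μ (fun a => φ a * g (a, true)) - ex μ (fun a => φ a * g (a, false)) := by
    rw [ex_sub, ex_mul_sub]
    exact ex_mul_ex_le_ex_mul hμ hφ0 hg0 hφm hgm
  nlinarith [mul_nonneg hIg (sub_nonneg.2 hFh), mul_nonneg hIh (sub_nonneg.2 hFg), mul_nonneg (mul_nonneg hA hIg) hIh]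

/-- **A COIN SEEN CONJUNCTIVELY BY TWO MEMBERS NEVER HURTS**: on an FKG poset `(α, μ)` times an independent coin of bias `p ∈ [0,1]`, if `f = φ(a)`
(`φ ≥ 0` monotone) ignores the coin and the coin-increments of `g` and `h` are nonnegative and monotone, then
`E_3(μ⊗coin_p; f,g,h) ≥ (1−p)·E_3(μ; φ, g₀, h₀) + p·E_3(μ; φ, g₁, h₁)`. [this work] -/
theorem sahiE_three_ge_sections_of_conjunctive [DistribLattice α] {μ : α → ℝ} (hμ : IsFKGMeasure μ) {p : ℝ} (hp0 : 0 ≤ p) (hp1 : p ≤ 1)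
    (φ : α → ℝ) (hφ0 : ∀ a, 0 ≤ φ a) (hφm : Monotone φ) (g h : α × Bool → ℝ)
    (hg0 : ∀ a, 0 ≤ g (a, true) - g (a, false)) (hgm : Monotone (fun a => g (a, true) - g (a, false)))
    (hh0 : ∀ a, 0 ≤ h (a, true) - h (a, false)) (hhm : Monotone (fun a => h (a, true) - h (a, false))) :
    (1 - p) * sahiE μ 3 ![φ, fun a => g (a, false), fun a => h (a, false)]
      + p * sahiE μ 3 ![φ, fun a => g (a, true), fun a => h (a, true)]
      ≤ sahiE (coinWeight μ p) 3 ![fun x => φ x.1, g, h] := by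
  have hmain := sahiE_three_ge_sections μ hp0 hp1 (fun x => φ x.1) g h
    (remainder_nonneg_of_conjunctive hμ p φ hφ0 hφm g h hg0 hgm hh0 hhm)
  exact hmain

/-- **Corollary**: under the same hypotheses, nonnegative sectional `E_3`'s give `E_3 ≥ 0` for the glued triple. [this work] -/
theorem sahiE_three_nonneg_of_conjunctive [DistribLattice α] {μ : α → ℝ} (hμ : IsFKGMeasure μ) {p : ℝ} (hp0 : 0 ≤ p) (hp1 : p ≤ 1)
    (φ : α → ℝ) (hφ0 : ∀ a, 0 ≤ φ a) (hφm : Monotone φ) (g h : α × Bool → ℝ)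
    (hg0 : ∀ a, 0 ≤ g (a, true) - g (a, false)) (hgm : Monotone (fun a => g (a, true) - g (a, false)))
    (hh0 : ∀ a, 0 ≤ h (a, true) - h (a, false)) (hhm : Monotone (fun a => h (a, true) - h (a, false)))
    (hsec0 : 0 ≤ sahiE μ 3 ![φ, fun a => g (a, false), fun a => h (a, false)])
    (hsec1 : 0 ≤ sahiE μ 3 ![φ, fun a => g (a, true), fun a => h (a, true)]) :
    0 ≤ sahiE (coinWeight μ p) 3 ![fun x => φ x.1, g, h] := by
  have h := sahiE_three_ge_sections_of_conjunctive hμ hp0 hp1 φ hφ0 hφm g h hg0 hgm hh0 hhm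
  have hq : 0 ≤ 1 - p := by linarith
  nlinarith [mul_nonneg hq hsec0, mul_nonneg hp0 hsec1]

end SahiCoordinateInfluence

end Summit.CriticalPhenomena.PercolationContinuityZ3.Theorems
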